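import Summits.ResolutionOfSingularities.ResolutionOfSingularities.Theorems.PurelyInseparableDim4SpineGame
import Literature.AlgebraicGeometry.Resolution.WeightedBlowupPairNoIncrease
import Literature.AlgebraicGeometry.Resolution.PointBlowupMohBound
import HarnessLib

/-!
# The Lorentz potential of the `t = 0` point blow-up (cell `res-dim4-pi`, CARD I-11-1, res-dim4-idea-11)

[OURS · CANDIDATE · counted 0] A RANK FUNCTION for pure point moves of the spine game (TY-9
`…SpineGame`: `SpinePos`, `pureMove`, `SpinePermissible`).  For an exponent `d` put
`twoE q d = |d|² − Σᵢ dᵢ² − 2q|d| = 2(e₂(d) − q|d|)`; under the chart-`j` exponent law of the POINT blow-up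
(`CentreBlowup.chartExponent q univ j : d_j ↦ |d| − q`) it rises by exactly `2(β_j(d) − q)²`,
`β_j(d) = |d| − d_j` (`twoE_chartExponent`, the card's identity C2).  Hence the potential
`Phi q A = Σ_{d∈A} max(0, −twoE q d)` is NON-INCREASING on every pure point move of a `q`-fold position
(`Phi_image_le`) and drops BY AT LEAST 2 when `A` is `q`-fold and AXIS-CLEAR, `∀ k ∃ d ∈ A, β_k(d) ≤ q − 1`
(`Phi_image_add_two_le`, `Phi_image_lt`, `Phi_pureMove_lt` = THEOREM S / claim C1 of the card), also
after deletions (`Phi_add_two_le_of_subset_image`); so a run of `L` point steps through `q`-fold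
axis-clear positions has `2L + Φ(A_L) ≤ Φ(A_0)` (`two_mul_length_le_Phi`, the EXPLICIT BUDGET) and there
is no infinite such branch (`no_infinite_axisClear_branch`, `no_infinite_axisClear_pointPlay`).
`AxisClear` is res-dim4-idea-3's «point-only»; the termination corollary is the statement T(n,q) of
ISO-SPINE-PO, landed FIRST by res-dim4-p-9 (`IsoSpine.noPointOnlySpineBranch`,
`Theorems/…IsoSpine{,Theorem}.lean`) and not re-claimed; what this file adds is the explicit monotone
quantity with an exact per-monomial identity and the budget.  Written by res-dim4-idea-11 (draft v2, sha16
724864968cd331cd); filed by res-dim4-typ-1 (header, docstrings, section-variable hygiene, two auxiliary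
lemmas replaced by their tree originals `WeightedBlowup.degree_eq_sum` / `PointBlowup.degree_update_add`).
Nothing here is about resolution of singularities in dimension ≥ 4 / characteristic `p`, which is NOT
proved.  Supports stmt-ResolutionOfSingularities-16155 (helper). bears_on: LADDER-RESOLUTION:D157-DOOR2
(res-dim4-pi · I-11-1).
-/

set_option linter.dupNamespace false -- mandated namespace of this single-conjunct summit

noncomputable section

namespace Summit.ResolutionOfSingularities.ResolutionOfSingularities.Theorems.PIDim4

namespace SpineAxisClear

open Finset Literature.AlgebraicGeometry.Resolution CentreBlowup

variable {σ : Type} [Fintype σ]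

/-- Each exponent is at most the total degree. [folklore] -/
theorem apply_le_degree (d : σ →₀ ℕ) (k : σ) : d k ≤ d.degree := by
  rw [WeightedBlowup.degree_eq_sum]
  exact Finset.single_le_sum (f := fun i => d i) (fun i _ => Nat.zero_le _) (Finset.mem_univ k)

/-- Transversal weighted order `β_k(d) = |d| − d_k = ord_{𝟙−e_k}(x^d)`. -/
def beta (k : σ) (d : σ →₀ ℕ) : ℕ := d.degree - d k

/-- `β_k(d) + d_k = |d|`. [folklore] -/
theorem beta_add_apply (k : σ) (d : σ →₀ ℕ) : beta k d + d k = d.degree := by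
  have := apply_le_degree d k
  unfold beta; omega

/-- AXIS-CLEAR: every coordinate axis carries a near-axis monomial (`β_k ≤ q − 1`), i.e. no coordinate
axis `V(x_i : i ≠ k)` is a permissible centre. -/
def AxisClear (q : ℕ) (A : Finset (σ →₀ ℕ)) : Prop := ∀ k : σ, ∃ d ∈ A, beta k d + 1 ≤ q

/-- Twice the Lorentz energy of a monomial: `|d|² − Σ dᵢ² − 2q|d|` (`= 2e₂(d) − 2q|d|`). -/
def twoE (q : ℕ) (d : σ →₀ ℕ) : ℤ := (d.degree : ℤ) ^ 2 - (∑ i, (d i : ℤ) ^ 2) - 2 * q * d.degree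

/-- The potential `Φ_q(A) = Σ_{d∈A} max(0, −2E_q(d))`. -/
def Phi (q : ℕ) (A : Finset (σ →₀ ℕ)) : ℕ := ∑ d ∈ A, (-twoE q d).toNat

/-- A near-axis witness of the played chart in a `q`-fold position has negative energy: `2E_q(w) ≤ −2`. -/
theorem twoE_le_of_witness (q : ℕ) (j : σ) (w : σ →₀ ℕ) (hq : q ≤ w.degree) (hw : beta j w + 1 ≤ q) :
    twoE q w ≤ -2 := by
  -- Σ wᵢ² ≥ w_j² + (|w| − w_j): squares dominate values off `j`
  have hsq : (w j : ℤ) ^ 2 + ((w.degree : ℤ) - w j) ≤ ∑ i, (w i : ℤ) ^ 2 := by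
    have h1 : (w j : ℤ) ^ 2 - w j ≤ ∑ i, ((w i : ℤ) ^ 2 - w i) :=
      Finset.single_le_sum (f := fun i => (w i : ℤ) ^ 2 - w i)
        (fun i _ => by nlinarith [Int.natCast_nonneg (w i)]) (Finset.mem_univ j)
    have h2 : ∑ i, ((w i : ℤ) ^ 2 - w i) = (∑ i, (w i : ℤ) ^ 2) - w.degree := by
      rw [Finset.sum_sub_distrib, WeightedBlowup.degree_eq_sum, Nat.cast_sum]
    linarith
  have hb' : (beta j w : ℤ) + w j = w.degree := by exact_mod_cast beta_add_apply j w
  have hw' : (beta j w : ℤ) + 1 ≤ q := by exact_mod_cast hw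
  have hq' : (q : ℤ) ≤ w.degree := by exact_mod_cast hq
  unfold twoE
  nlinarith [Int.natCast_nonneg (w j), Int.natCast_nonneg (beta j w)]

variable [DecidableEq σ]

/-- Bookkeeping: a `Fintype` sum changed at one place. [folklore] -/
theorem sum_update_add {M : Type} [AddCommMonoid M] (g : σ → M) (i : σ) (a : M) :
    ∑ e, Function.update g i a e + g i = ∑ e, g e + a := by
  rw [Finset.sum_update_of_mem (Finset.mem_univ i),
    Finset.sum_eq_add_sum_sdiff_singleton_of_mem (Finset.mem_univ i) g]
  abel

/-- The point chart law is an update of the `j`-th exponent. -/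
theorem chartExponent_univ_eq (q : ℕ) (j : σ) (d : σ →₀ ℕ) :
    chartExponent q univ j d = d.update j (d.degree - q) := by
  rw [chartExponent, degIn_univ]

/-- Sum of squares of an updated exponent vector. -/
theorem sumsq_update_add (d : σ →₀ ℕ) (j : σ) (v : ℕ) :
    (∑ i, ((d.update j v) i : ℤ) ^ 2) + (d j : ℤ) ^ 2 = (∑ i, (d i : ℤ) ^ 2) + (v : ℤ) ^ 2 := by
  have h := sum_update_add (fun i => (d i : ℤ) ^ 2) j ((v : ℤ) ^ 2)
  have h1 : (∑ i, ((d.update j v) i : ℤ) ^ 2) = ∑ e, Function.update (fun i => (d i : ℤ) ^ 2) j ((v : ℤ) ^ 2) e := by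
    refine Finset.sum_congr rfl fun i _ => ?_
    rw [Finsupp.coe_update, Function.apply_update (fun _ (n : ℕ) => (n : ℤ) ^ 2) (⇑d) j v i]
  rw [h1]; exact h

/-- KEY IDENTITY (C2 of the card): `2E_q(m_j d) = 2E_q(d) + 2(β_j(d) − q)²` when `q ≤ |d|`. -/
theorem twoE_chartExponent (q : ℕ) (j : σ) (d : σ →₀ ℕ) (hq : q ≤ d.degree) :
    twoE q (chartExponent q univ j d) = twoE q d + 2 * ((beta j d : ℤ) - q) ^ 2 := by
  have hb : (beta j d : ℤ) + d j = d.degree := by exact_mod_cast beta_add_apply j d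
  have hdeg : ((d.update j (d.degree - q)).degree : ℤ) + d j = d.degree + (d.degree - q : ℕ) := by
    exact_mod_cast PointBlowup.degree_update_add d j (d.degree - q)
  have hsq := sumsq_update_add d j (d.degree - q)
  rw [Nat.cast_sub hq] at hdeg hsq
  rw [chartExponent_univ_eq]
  unfold twoE
  nlinarith [hdeg, hsq, hb]

/-- Every summand of `Φ` is non-increasing under the pure point move. -/
theorem term_chartExponent_le (q : ℕ) (j : σ) (d : σ →₀ ℕ) (hq : q ≤ d.degree) :
    (-twoE q (chartExponent q univ j d)).toNat ≤ (-twoE q d).toNat := by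
  rw [twoE_chartExponent q j d hq]
  apply Int.toNat_le_toNat
  nlinarith [sq_nonneg ((beta j d : ℤ) - q)]

/-- The witness summand drops by at least `2` (in `twoE` units). -/
theorem term_chartExponent_add_two_le (q : ℕ) (j : σ) (w : σ →₀ ℕ) (hq : q ≤ w.degree)
    (hw : beta j w + 1 ≤ q) :
    (-twoE q (chartExponent q univ j w)).toNat + 2 ≤ (-twoE q w).toNat := by
  have hE := twoE_le_of_witness q j w hq hw
  rw [twoE_chartExponent q j w hq]
  have h0 : (0 : ℤ) ≤ -twoE q w := by linarith
  have hsq : (1 : ℤ) ≤ ((beta j w : ℤ) - q) ^ 2 := by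
    have hw' : (beta j w : ℤ) - q ≤ -1 := by
      have : (beta j w : ℤ) + 1 ≤ q := by exact_mod_cast hw
      linarith
    nlinarith
  zify
  rw [Int.toNat_of_nonneg h0]
  rcases le_or_gt 0 (-(twoE q w + 2 * ((beta j w : ℤ) - q) ^ 2)) with h1 | h1
  · rw [Int.toNat_of_nonneg h1]; linarith
  · rw [Int.toNat_eq_zero.mpr h1.le]; push_cast; linarith

/-- The witness summand drops strictly. -/
theorem term_chartExponent_lt (q : ℕ) (j : σ) (w : σ →₀ ℕ) (hq : q ≤ w.degree) (hw : beta j w + 1 ≤ q) :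
    (-twoE q (chartExponent q univ j w)).toNat < (-twoE q w).toNat := by
  have := term_chartExponent_add_two_le q j w hq hw
  omega

/-- The pure point move is injective on `q`-fold positions. -/
theorem chartExponent_injOn (q : ℕ) (j : σ) (A : Finset (σ →₀ ℕ)) (hA : ∀ d ∈ A, q ≤ d.degree) :
    Set.InjOn (chartExponent q univ j) A := by
  intro d hd d' hd' h
  rw [chartExponent_univ_eq, chartExponent_univ_eq] at h
  have hi : ∀ i, (d.update j (d.degree - q)) i = (d'.update j (d'.degree - q)) i := fun i => by rw [h]
  have hoff : ∀ i, i ≠ j → d i = d' i := by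
    intro i hij
    have := hi i
    simpa [Finsupp.coe_update, Function.update_of_ne hij] using this
  have hjj : d.degree - q = d'.degree - q := by
    have := hi j
    simpa [Finsupp.coe_update] using this
  have hdeg : (d.update j (d.degree - q)).degree = (d'.update j (d'.degree - q)).degree := by rw [h]
  have h1 := PointBlowup.degree_update_add d j (d.degree - q)
  have h2 := PointBlowup.degree_update_add d' j (d'.degree - q)
  have hq1 := hA d hd
  have hq2 := hA d' hd'
  have hj : d j = d' j := by omega
  ext i
  by_cases hij : i = j
  · subst hij; exact hj
  · exact hoff i hij

/-- THEOREM S (C1 of the card) for any number of variables: on a `q`-fold axis-clear position the pure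
point move strictly decreases `Φ`. -/
theorem Phi_image_lt (q : ℕ) (j : σ) (A : Finset (σ →₀ ℕ)) (hA : ∀ d ∈ A, q ≤ d.degree)
    (hC : AxisClear q A) :
    Phi q (A.image (chartExponent q univ j)) < Phi q A := by
  unfold Phi
  rw [Finset.sum_image (chartExponent_injOn q j A hA)]
  obtain ⟨w, hw, hwq⟩ := hC j
  exact Finset.sum_lt_sum (fun d hd => term_chartExponent_le q j d (hA d hd))
    ⟨w, hw, term_chartExponent_lt q j w (hA w hw) hwq⟩

/-- `Φ` is non-increasing under EVERY pure point move of a `q`-fold position (no axis-clear needed). -/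
theorem Phi_image_le (q : ℕ) (j : σ) (A : Finset (σ →₀ ℕ)) (hA : ∀ d ∈ A, q ≤ d.degree) :
    Phi q (A.image (chartExponent q univ j)) ≤ Phi q A := by
  unfold Phi
  rw [Finset.sum_image (chartExponent_injOn q j A hA)]
  exact Finset.sum_le_sum fun d hd => term_chartExponent_le q j d (hA d hd)

/-- Quantitative form: `Φ(σ_j A) + 2 ≤ Φ(A)` on a `q`-fold axis-clear position. -/
theorem Phi_image_add_two_le (q : ℕ) (j : σ) (A : Finset (σ →₀ ℕ)) (hA : ∀ d ∈ A, q ≤ d.degree)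
    (hC : AxisClear q A) :
    Phi q (A.image (chartExponent q univ j)) + 2 ≤ Phi q A := by
  unfold Phi
  rw [Finset.sum_image (chartExponent_injOn q j A hA)]
  obtain ⟨w, hw, hwq⟩ := hC j
  have hsplit := Finset.add_sum_erase A (fun d => (-twoE q (chartExponent q univ j d)).toNat) hw
  have hsplit' := Finset.add_sum_erase A (fun d => (-twoE q d).toNat) hw
  have hrest : ∑ d ∈ A.erase w, (-twoE q (chartExponent q univ j d)).toNat ≤
      ∑ d ∈ A.erase w, (-twoE q d).toNat :=
    Finset.sum_le_sum fun d hd => term_chartExponent_le q j d (hA d (Finset.mem_of_mem_erase hd))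
  have hw2 := term_chartExponent_add_two_le q j w (hA w hw) hwq
  rw [← hsplit, ← hsplit']
  omega

/-- DELETION FORM (cleaning only deletes monomials): any `A' ⊆ σ_j(A)` has `Φ(A') + 2 ≤ Φ(A)`. -/
theorem Phi_add_two_le_of_subset_image (q : ℕ) (j : σ) (A A' : Finset (σ →₀ ℕ))
    (hA : ∀ d ∈ A, q ≤ d.degree) (hC : AxisClear q A) (hsub : A' ⊆ A.image (chartExponent q univ j)) :
    Phi q A' + 2 ≤ Phi q A := by
  have h1 : Phi q A' ≤ Phi q (A.image (chartExponent q univ j)) := by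
    unfold Phi; exact Finset.sum_le_sum_of_subset hsub
  have h2 := Phi_image_add_two_le q j A hA hC
  omega

/-- EXPLICIT BUDGET (any index type, deletions allowed): a run of `L` consecutive point-blow-up
steps through `q`-fold axis-clear positions costs `2L ≤ Φ(A₀) − Φ(A_L)`; in particular
`2L ≤ Φ(A₀)`. -/
theorem two_mul_length_le_Phi (q : ℕ) (A : ℕ → Finset (σ →₀ ℕ)) (j : ℕ → σ) (L : ℕ)
    (h : ∀ t < L, (∀ d ∈ A t, q ≤ d.degree) ∧ AxisClear q (A t) ∧
      A (t + 1) ⊆ (A t).image (chartExponent q univ (j t))) :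
    2 * L + Phi q (A L) ≤ Phi q (A 0) := by
  induction L with
  | zero => simp
  | succ L ih =>
    have hL := h L (Nat.lt_succ_self L)
    have hstep := Phi_add_two_le_of_subset_image q (j L) (A L) (A (L + 1)) hL.1 hL.2.1 hL.2.2
    have ih' := ih fun t ht => h t (Nat.lt_succ_of_lt ht)
    omega

/-- No infinite branch (any index type, deletions allowed) through `q`-fold axis-clear positions —
the statement `IsoSpine.NoPointOnlySpineBranch` of CARD I-3-4 (res-dim4-idea-3 / p-9), here as a
one-line consequence of the budget. -/
theorem no_infinite_axisClear_branch (q : ℕ) :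
    ¬ ∃ (A : ℕ → Finset (σ →₀ ℕ)) (j : ℕ → σ),
      ∀ t, (∀ d ∈ A t, q ≤ d.degree) ∧ AxisClear q (A t) ∧
        A (t + 1) ⊆ (A t).image (chartExponent q univ (j t)) := by
  rintro ⟨A, j, h⟩
  have := two_mul_length_le_Phi q A j (Phi q (A 0) + 1) fun t _ => h t
  omega

/-- THEOREM S typed over TY-9 (`SpinePos`, `pureMove`, `SpinePermissible`). -/
theorem Phi_pureMove_lt (q : ℕ) (j : Fin 4) (A : SpinePos)
    (hP : SpinePermissible q Finset.univ A) (hA : AxisClear q A) :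
    Phi q (pureMove q Finset.univ j A) < Phi q A := by
  unfold pureMove
  refine Phi_image_lt q j A (fun d hd => ?_) hA
  have := hP.2 d hd
  rwa [degIn_univ] at this

/-- COROLLARY: no infinite pure point play through `q`-fold axis-clear positions (hence, with the
Support Lemma `¬AxisClear → ¬IsIsolated` of the card, F4-I ∩ SPINE for every `q`). -/
theorem no_infinite_axisClear_pointPlay (q : ℕ) :
    ¬ ∃ (A : ℕ → SpinePos) (j : ℕ → Fin 4),
      ∀ t, SpinePermissible q Finset.univ (A t) ∧ AxisClear q (A t) ∧
        A (t + 1) = pureMove q Finset.univ (j t) (A t) := by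
  rintro ⟨A, j, h⟩
  have hlt : ∀ t, Phi q (A (t + 1)) < Phi q (A t) := fun t => by
    rw [(h t).2.2]; exact Phi_pureMove_lt q (j t) (A t) (h t).1 (h t).2.1
  have hle : ∀ t, Phi q (A t) + t ≤ Phi q (A 0) := by
    intro t
    induction t with
    | zero => simp
    | succ t ih => have := hlt t; omega
  have := hle (Phi q (A 0) + 1)
  omega

end SpineAxisClear

end Summit.ResolutionOfSingularities.ResolutionOfSingularities.Theorems.PIDim4
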